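import Literature.NumberTheory.IwasawaTheory.ClassicalMuVanishesDivisionFieldFiveNonsplit
import Literature.NumberTheory.EllipticCurves.FineSelmerClassGroupCriterion
import HarnessLib

set_option autoImplicit false

/-!
# Statement (A) of Coates–Sujatha at `p = 5` for curves whose mod-5 image is the normaliser of a non-split Cartan subgroup, from
# `μ = 0` of seven subfields of `ℚ(E[5])` (road (b): `CoatesSujatha2005.thm34` ∘ `ClassicalMuVanishesDivisionFieldFiveNonsplit`)

Topic `NumberTheory/EllipticCurves`; THEOREM-ONLY file (no definition, no named fact, no `sorry`); literature seat `bsd-potss-conjA-anchor`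
g12 (supports the KT fine-Selmer crux stmt-BirchSwinnertonDyer-19413 and its residue parent 19916, rows with image `N_ns(5)` = LMFDB `5Nn`;
closes nothing).  The composite of the named fact `CoatesSujatha2005.thm34_fineSelmerDual_moduleFinite_of_classicalMuVanishes_divisionField`
(road (b)) with `classicalMuVanishes_divisionField_of_nonsplitCartanBasis_five`: statement (A) for `E` at `5` (`Sel₀(E/ℚ_cyc)^∨` finitely
generated over `ℤ_5`, in the tree's `∃ γ D, Module.Finite ℤ_[5] D.X` form) from a basis `e` of `E[5]` in which `Γ_ℚ` acts through
`C_ns⁺(ε)`, two elements `σ_x, σ_s ∈ Γ_ℚ` acting as `R_ε = (1 ε(4−ε); 4−ε 1)` and `S = diag(1, −1)`, and «`μ = 0`» for the seven fields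
`ℚ(P₁) = ℚ(E[5])^{⟨σ̄_s⟩}` (degree 24), `ℚ(E[5])^{⟨σ̄_x¹², σ̄_s⟩}` (12), `ℚ(E[5])^{⟨σ̄_x⁶σ̄_s⟩}` (12), `ℚ(E[5])^{⟨σ̄_x³⟩}` (6),
`ℚ(E[5])^{⟨σ̄_x⁶, σ̄_s⟩}` (6), `ℚ(E[5])^{⟨σ̄_x⁶, σ̄_x³σ̄_s⟩}` (6), `ℚ(E[5])^{⟨σ̄_x³, σ̄_s⟩}` (3) — the ONLY named fact on the way is
Coates–Sujatha Thm. 3.4 (no growth theorem, no Ferrero–Washington).  The second theorem takes the tree predicate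
`HasModPImageEqNonsplitCartanNormalizer E 5` and a `μ`-input quantified over all such bases (for consumers who do not fix a basis).

References: [CoatesSujatha2005, Thm. 3.4]; [KuriharaPollack2007, §3.1]; [Lemmermeyer1994, §1]; [Washington1997, §13.1]; [Serre1972, §2.2];
[FurioLombardo2023, Thm. 1.5].
-/

noncomputable section

open scoped NumberField Matrix

open Field IntermediateField WeierstrassCurve Literature.NumberTheory.EllipticCurves Literature.NumberTheory.GaloisRepresentations
  Literature.NumberTheory.SerreUniformity Literature.NumberTheory.IwasawaTheory

namespace Literature.NumberTheory.EllipticCurves.CoatesSujatha2005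

/-- **Statement (A) at `5` for non-split-Cartan-normaliser image, from `μ = 0` of seven subfields of `ℚ(E[5])`** (modulo Coates–Sujatha
Thm. 3.4 alone, a named fact): with `e`, `ε`, `σ_x, σ_s` and the seven `μ`-inputs as in `classicalMuVanishes_divisionField_of_nonsplitCartanBasis_five`,
for every cyclotomic `ℤ_5`-extension `κ` of `ℚ` the dual fine Selmer group of `E` over `ℚ_cyc` is finitely generated over `ℤ_5`.
[cite: CoatesSujatha2005, Thm. 3.4 (§3)] [cite: KuriharaPollack2007, §3.1] [cite: Lemmermeyer1994, §1 (Kuroda's class number formula)]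
[cite: Serre1972, §2.2 (non-split Cartan subgroups, normalisers)] -/
theorem fineSelmerDual_moduleFinite_of_nonsplitCartanBasis_five
    (hCS : thm34_fineSelmerDual_moduleFinite_of_classicalMuVanishes_divisionField) [Fact (Nat.Prime 5)] (W : WeierstrassCurve ℚ)
    [W.IsElliptic] (e : W.geomTorsion (5 : ℕ) ≃+ (Fin 2 → ZMod 5)) {ε : ZMod 5} (hε : ¬ IsSquare ε)
    (he : ∀ σ : absoluteGaloisGroup ℚ, ∃ M ∈ nonsplitCartanNormalizer ε, ∀ P : W.geomTorsion (5 : ℕ), e (σ • P) = M *ᵥ e P)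
    (σx σs : absoluteGaloisGroup ℚ) (hσx : ∀ P : W.geomTorsion (5 : ℕ), e (σx • P) = !![1, ε * (4 - ε); 4 - ε, 1] *ᵥ e P)
    (hσs : ∀ P : W.geomTorsion (5 : ℕ), e (σs • P) = !![1, 0; 0, 4] *ᵥ e P)
    (hμP : ∀ κE : ZpExtension ↥(fixedField (Subgroup.zpowers (absRestrictNormalHom (W.divisionField 5) σs))) 5,
      κE.IsCyclotomic → ClassicalMuVanishes κE)
    (hμB₁ : ∀ κE : ZpExtension ↥(fixedField (Subgroup.zpowers (absRestrictNormalHom (W.divisionField 5) σx ^ 12) ⊔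
        Subgroup.zpowers (absRestrictNormalHom (W.divisionField 5) σs))) 5,
      κE.IsCyclotomic → ClassicalMuVanishes κE)
    (hμB₁' : ∀ κE : ZpExtension ↥(fixedField (Subgroup.zpowers (absRestrictNormalHom (W.divisionField 5) σx ^ 6 *
        absRestrictNormalHom (W.divisionField 5) σs))) 5,
      κE.IsCyclotomic → ClassicalMuVanishes κE)
    (hμS : ∀ κE : ZpExtension ↥(fixedField (Subgroup.zpowers (absRestrictNormalHom (W.divisionField 5) σx ^ 3))) 5,
      κE.IsCyclotomic → ClassicalMuVanishes κE)
    (hμB₂ : ∀ κE : ZpExtension ↥(fixedField (Subgroup.zpowers (absRestrictNormalHom (W.divisionField 5) σx ^ 6) ⊔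
        Subgroup.zpowers (absRestrictNormalHom (W.divisionField 5) σs))) 5,
      κE.IsCyclotomic → ClassicalMuVanishes κE)
    (hμB₂' : ∀ κE : ZpExtension ↥(fixedField (Subgroup.zpowers (absRestrictNormalHom (W.divisionField 5) σx ^ 6) ⊔
        Subgroup.zpowers (absRestrictNormalHom (W.divisionField 5) σx ^ 3 * absRestrictNormalHom (W.divisionField 5) σs))) 5,
      κE.IsCyclotomic → ClassicalMuVanishes κE)
    (hμB₃ : ∀ κE : ZpExtension ↥(fixedField (Subgroup.zpowers (absRestrictNormalHom (W.divisionField 5) σx ^ 3) ⊔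
        Subgroup.zpowers (absRestrictNormalHom (W.divisionField 5) σs))) 5,
      κE.IsCyclotomic → ClassicalMuVanishes κE)
    (κ : ZpExtension ℚ 5) (hκ : κ.IsCyclotomic) :
    ∃ (γ : absoluteGaloisGroup ℚ) (D : W.FineSelmerDualData κ γ), Module.Finite ℤ_[5] (RestrictScalars ℤ_[5] (IwasawaAlgebra 5) D.X) :=
  hCS W 5 (by decide)
    (classicalMuVanishes_divisionField_of_nonsplitCartanBasis_five W e hε he σx σs hσx hσs hμP hμB₁ hμB₁' hμS hμB₂ hμB₂' hμB₃) κ hκ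

/-- **Statement (A) at `5` from the predicate `HasModPImageEqNonsplitCartanNormalizer E 5`** (modulo Coates–Sujatha Thm. 3.4 alone): if for
EVERY basis `e`, non-square `ε` and `σ_x, σ_s ∈ Γ_ℚ` acting as `R_ε`, `S` the seven `μ`-inputs hold, then (A) holds for `E` at `5`.  The
quantified input is how a consumer who starts from the tree predicate (second alternative of Furio–Lombardo Thm. 1.5) and does not fix a
basis feeds the seven fields; `exists_nonsplitCartanBasis_of_hasModPImageEqNonsplitCartanNormalizer_five` supplies the data.
[cite: CoatesSujatha2005, Thm. 3.4 (§3)] [cite: FurioLombardo2023, Thm. 1.5] [cite: Lemmermeyer1994, §1] -/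
theorem fineSelmerDual_moduleFinite_of_hasModPImageEqNonsplitCartanNormalizer_five
    (hCS : thm34_fineSelmerDual_moduleFinite_of_classicalMuVanishes_divisionField) [Fact (Nat.Prime 5)] (W : WeierstrassCurve ℚ)
    [W.IsElliptic] (himg : HasModPImageEqNonsplitCartanNormalizer W 5)
    (hμ : ∀ (e : W.geomTorsion (5 : ℕ) ≃+ (Fin 2 → ZMod 5)) (ε : ZMod 5), ¬ IsSquare ε →
      (∀ σ : absoluteGaloisGroup ℚ, ∃ M ∈ nonsplitCartanNormalizer ε, ∀ P : W.geomTorsion (5 : ℕ), e (σ • P) = M *ᵥ e P) →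
      ∀ σx σs : absoluteGaloisGroup ℚ, (∀ P : W.geomTorsion (5 : ℕ), e (σx • P) = !![1, ε * (4 - ε); 4 - ε, 1] *ᵥ e P) →
        (∀ P : W.geomTorsion (5 : ℕ), e (σs • P) = !![1, 0; 0, 4] *ᵥ e P) →
      (∀ κE : ZpExtension ↥(fixedField (Subgroup.zpowers (absRestrictNormalHom (W.divisionField 5) σs))) 5,
        κE.IsCyclotomic → ClassicalMuVanishes κE) ∧
      (∀ κE : ZpExtension ↥(fixedField (Subgroup.zpowers (absRestrictNormalHom (W.divisionField 5) σx ^ 12) ⊔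
          Subgroup.zpowers (absRestrictNormalHom (W.divisionField 5) σs))) 5,
        κE.IsCyclotomic → ClassicalMuVanishes κE) ∧
      (∀ κE : ZpExtension ↥(fixedField (Subgroup.zpowers (absRestrictNormalHom (W.divisionField 5) σx ^ 6 *
          absRestrictNormalHom (W.divisionField 5) σs))) 5,
        κE.IsCyclotomic → ClassicalMuVanishes κE) ∧
      (∀ κE : ZpExtension ↥(fixedField (Subgroup.zpowers (absRestrictNormalHom (W.divisionField 5) σx ^ 3))) 5,
        κE.IsCyclotomic → ClassicalMuVanishes κE) ∧
      (∀ κE : ZpExtension ↥(fixedField (Subgroup.zpowers (absRestrictNormalHom (W.divisionField 5) σx ^ 6) ⊔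
          Subgroup.zpowers (absRestrictNormalHom (W.divisionField 5) σs))) 5,
        κE.IsCyclotomic → ClassicalMuVanishes κE) ∧
      (∀ κE : ZpExtension ↥(fixedField (Subgroup.zpowers (absRestrictNormalHom (W.divisionField 5) σx ^ 6) ⊔
          Subgroup.zpowers (absRestrictNormalHom (W.divisionField 5) σx ^ 3 * absRestrictNormalHom (W.divisionField 5) σs))) 5,
        κE.IsCyclotomic → ClassicalMuVanishes κE) ∧
      (∀ κE : ZpExtension ↥(fixedField (Subgroup.zpowers (absRestrictNormalHom (W.divisionField 5) σx ^ 3) ⊔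
          Subgroup.zpowers (absRestrictNormalHom (W.divisionField 5) σs))) 5,
        κE.IsCyclotomic → ClassicalMuVanishes κE))
    (κ : ZpExtension ℚ 5) (hκ : κ.IsCyclotomic) :
    ∃ (γ : absoluteGaloisGroup ℚ) (D : W.FineSelmerDualData κ γ), Module.Finite ℤ_[5] (RestrictScalars ℤ_[5] (IwasawaAlgebra 5) D.X) := by
  obtain ⟨e, ε, hε, he, σx, σs, hσx, hσs⟩ := exists_nonsplitCartanBasis_of_hasModPImageEqNonsplitCartanNormalizer_five W himg
  obtain ⟨hμP, hμB₁, hμB₁', hμS, hμB₂, hμB₂', hμB₃⟩ := hμ e ε hε he σx σs hσx hσs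
  exact fineSelmerDual_moduleFinite_of_nonsplitCartanBasis_five hCS W e hε he σx σs hσx hσs hμP hμB₁ hμB₁' hμS hμB₂ hμB₂' hμB₃ κ hκ

end Literature.NumberTheory.EllipticCurves.CoatesSujatha2005

end
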